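import Summits.QuantumFields.BalabanUV.T4Continuum.Support.CTGaugeSlotHbd
import Summits.QuantumFields.BalabanUV.T4Continuum.Support.CovariantVectorCoerciveHolo

/-!
# T⁴ programme, spine node NE2 (U1a), sub-row Δ3 «NE2-WALK» (T4-DAG `T4-U1a.S-NE2-D3-WALK°`) — THE BACKGROUND FAMILY's UNIT DATUM
# `Coercive σU (Q′_UG′_UG′_UQ′_Uᴴ)` IS A THEOREM: coercivity of the free datum (`σ₀²`, substrate) perturbed by `‖K_U − K_1‖ ≤ deltaKB`
# (row B4's Gram-difference algebra `GaugeTermResolventBounds.opNorm_inv_sub_inv_le_gram`); ROOT B's decay stations with NO analytic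
# input beyond the END of record — file E4 of «Δ3-CT-HBD-B4» («Δ3-CT-HKU»)

NE2 formalisation swarm `b2b-balaban-t4-ne2-formalise-*`, leaf prover 06 (gen 3), supplier item «Δ3-CT-HKU» = file E4 (chain «Δ3-CT» p220700∕p220892,
«Δ3-CT-HBD» p221704∕p221931, «Δ3-CT-HBD-B3» p223352∕p223438, «Δ3-CT-HJ», «Δ3-CT-HBD-B4» E1–E3; owner ruling R21 (c)).  File E3 displays
`hKU : ∀ k, Coercive σU K_{U,k}`, `K_U = Q′_UG′_UG′_UQ′_Uᴴ`.  Here it is DISCHARGED from the sizes of the (3.35)-class alone: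
 * §1 the generic perturbation `Coercive σ K`, `‖K′ − K‖ ≤ δ` ⟹ `Coercive (σ − δ) K′` is the substrate's
   `CovariantVectorCoerciveHolo.coercive_of_opNorm_sub_le` (consumed BY NAME);
 * §2 `deltaKB d a′ α τ` and **`opNorm_gramK_sub_gramK_one_le`**: at one level, for a family `(R, T)` with `‖n(R − 1)‖ ≤ α`, `‖T − 1‖ ≤ τ`:
   `‖K_U − K_1‖ ≤ deltaKB` (`G_U − G_1` by `GaugeTermResolventBounds.opNorm_inv_sub_inv_le_gram` with `W = D_R − ∂⊗1 = defect`,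
   `‖W‖ ≤ dα` (`GaugeTermDecomposition.opNorm_defect_le`), `‖Y_U − Y_1‖ ≤ a′τ(2 + 2τ)`-type (`GaugeTermPerturbationLaw.opNorm_mass_sub_le`); then
   `GaugeTermTwoLevelNumbers.opNorm_mul_sub_mul_le`, `opNorm_gramK_sub_le`), hence **`coercive_gramK_family`**: `Coercive (σ₀² − deltaKB) K_U`
   (E3's `coercive_gramK_one` perturbed);
 * §3 **`balaban_final_decayStations_of_regular_numeric`** — THE OWNER's ROOT-B DECAY STATIONS with `hdec` fed by the whole chain AND `hKU`
   discharged: beyond the END of record's binders (`hreg`, `hNE3` BY NAME and OPEN, `a′`, `η`-threshold, `‖t‖ ≤ 1`) ONLY an auxiliary mass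
   `a″ > 0` and NUMERIC smallness conditions on `(κ, t)` and on the class size `α` (through `deltaKB < σ₀²`, `γ_U − Jcov > 0`) remain.

HONEST FRAMING (T4-DAG p. 1).  Bookkeeping over landed modules ([folklore]); statements and the constant `deltaKB` OURS; MODEL level (transporters
DATA, no B0); `hNE3` OPEN; the numeric conditions are NOT verified for [B9]'s constants and do NOT reach `t = 1` (E3's `kappa4CT` bounds the
two gauge sandwiches separately and does not vanish with the background — a small-field ∕ small-COUPLING ∕ small-rate regime; the conjugated
DIFFERENCE of the two sandwiches is the follow-up that restores `t = 1` under a threshold); explicit admissible `κ` NOT computed; Δ3's decay binder is thereby reduced to arithmetic on displayed constants,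
but Δ3 as a ROW (the spine estimate NE2) is NOT closed; NE2 (U1a) NOT PROVED; NE3 OPEN; spine PROVED 0/9 unchanged; NOT infinite volume, NOT a
mass gap, NOT the Clay problem, NOT summit progress.  HONEST DEPENDENCY: continuum YM on T⁴ ⇐ BetaPertH ∧ nine spine estimates (0/9 proved);
BetaPertH ⇐ (D1) ∧ (D4) ∧ CAP+tail; G-an2-4 gates asym, D1 and NE2/3/4.  ABSOLUTE RULE kept; no `sorry`.
-/

noncomputable section

open scoped BigOperators ComplexConjugate Matrix Matrix.Norms.L2Operator Kronecker ComplexOrder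

namespace Summit.QuantumFields.BalabanUV.T4Continuum.CTGaugeUnitDatum

open Literature.MathematicalPhysics.QuantumFieldTheory.Balaban1983to89.B5Prop11Plancherel (Cst Cst_nonneg Tor fine unitVec)
open Literature.MathematicalPhysics.QuantumFieldTheory.Balaban1983to89.B5Prop11Lower (nsq nsq_nonneg norm_form_le)
open Literature.MathematicalPhysics.QuantumFieldTheory.Balaban1983to89.B5G183RateUnitTower (lev lev_neZero)
open Literature.MathematicalPhysics.QuantumFieldTheory.Balaban1983to89.B5Action121 (GradOp)
open Literature.MathematicalPhysics.QuantumFieldTheory.Balaban1983to89.T4EtaRateMin (LocalRate)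
open Summit.QuantumFields.BalabanUV.T4Continuum
open Summit.QuantumFields.BalabanUV.T4Continuum.CoerciveInverseTower (Coercive)
open Summit.QuantumFields.BalabanUV.T4Continuum.BalabanAveragedTowerUnit (idx one_le_lev')
open Summit.QuantumFields.BalabanUV.T4Continuum.BackgroundResolventTower
open Summit.QuantumFields.BalabanUV.T4Continuum.KingPairingPlantedLaw (calDalev CJ)
open Summit.QuantumFields.BalabanUV.T4Continuum.BlockMultiplication (siteMul siteMul_one opNorm_siteMul_le)
open Summit.QuantumFields.BalabanUV.T4Continuum.GramPerturbationLaw (C2gram)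
open Summit.QuantumFields.BalabanUV.T4Continuum.NE2FromNE3 (bgReadings)
open Summit.QuantumFields.BalabanUV.T4Continuum.NE2ColourPerturbedLayer (pertCovC pertLimC)
open Summit.QuantumFields.BalabanUV.T4Continuum.RegularBackgroundTower (RegularTransporters regClass betaNE3)
open Summit.QuantumFields.BalabanUV.T4Continuum.GaugeTermDecomposition (covGrad defect connL covGrad_eq covGrad_one opNorm_defect_le)
open Summit.QuantumFields.BalabanUV.T4Continuum.GaugeTermResolventBounds (opNorm_inv_sub_inv_le_gram)
open Summit.QuantumFields.BalabanUV.T4Continuum.GaugeTermTwoLevelNumbers (opNorm_gramK_sub_le opNorm_mul_sub_mul_le)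
open Summit.QuantumFields.BalabanUV.T4Continuum.GaugeTermScalarData (QuT Q1)
open Summit.QuantumFields.BalabanUV.T4Continuum.RegularSiteTransporters (siteT norm_siteT_sub_one_le)
open Summit.QuantumFields.BalabanUV.T4Continuum.NestedContourTransport (theta0)
open Summit.QuantumFields.BalabanUV.T4Continuum.NE2BalabanRoot (balabanPert)
open Summit.QuantumFields.BalabanUV.T4Continuum.NE2BalabanGauge (gaugeSlot liftR)
open Summit.QuantumFields.BalabanUV.T4Continuum.NE2BalabanLayerSharp (kappaBs C2Bs)
open Summit.QuantumFields.BalabanUV.T4Continuum.NE2BalabanWiring (epsR CdeltaR)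
open Summit.QuantumFields.BalabanUV.T4Continuum.NE2BalabanFinal (kappa4F C4F)
open Summit.QuantumFields.BalabanUV.T4Continuum.NE2BalabanThreshold (etaStar)
open Summit.QuantumFields.BalabanUV.T4Continuum.DecayRateInterpolation (EntryDecay DecayRate TwoLevelDecayRate)
open Summit.QuantumFields.BalabanUV.T4Continuum.ScalarAveragedPropagator (gammaPs)
open Summit.QuantumFields.BalabanUV.T4Continuum.ScalarAveragedCompression (sigma0)
open Summit.QuantumFields.BalabanUV.T4Continuum.ScalarCovariantLaplacian (scalarOp connS Bs opNorm_Bs_le)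
open Summit.QuantumFields.BalabanUV.T4Continuum.ScalarCovariantCoercive (gammaU Jcov Jcov_nonneg opNorm_siteMul_sub_one_le opNorm_siteMul_le_one_add
  opNorm_scalarOp_inv_le isUnit_scalarOp)
open Summit.QuantumFields.BalabanUV.T4Continuum.CTWeightedCoercivity
open Summit.QuantumFields.BalabanUV.T4Continuum.CTScalarGreen (Jfree)
open Summit.QuantumFields.BalabanUV.T4Continuum.CTGaugeTerm (deltaK)
open Summit.QuantumFields.BalabanUV.T4Continuum.CTVectorPropagator (JA)
open Summit.QuantumFields.BalabanUV.T4Continuum.CTKingTowerWeights (rho distKC)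
open Summit.QuantumFields.BalabanUV.T4Continuum.CTCovariantLaplacianDecay (kappaColCT)
open Summit.QuantumFields.BalabanUV.T4Continuum.CTAveragingSummandHbd (kappaAvgCT)
open Summit.QuantumFields.BalabanUV.T4Continuum.CTCovariantScalarGreen (scalarOp_eq_gram massTerm_posSemidef)
open Summit.QuantumFields.BalabanUV.T4Continuum.CTGaugeSandwichHbd (scalarOp_inv_isHermitian)
open Summit.QuantumFields.BalabanUV.T4Continuum.CTGaugeUnitFactorHbd (deltaKU)
open Summit.QuantumFields.BalabanUV.T4Continuum.CTGaugeSlotHbd (kappa4CT coercive_gramK_one balaban_final_decayStations_of_regular_unitDatum)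
open Summit.QuantumFields.BalabanUV.T4Continuum.DirichletRegionTower (gamD)
open Summit.QuantumFields.BalabanUV.T4Continuum.CovariantVectorCoerciveHolo (coercive_of_opNorm_sub_le)

variable {d : ℕ}

/-! ## §1 Coercivity is stable under small perturbations: the substrate's `CovariantVectorCoerciveHolo.coercive_of_opNorm_sub_le` -/

/-! ## §2 `‖K_U − K_1‖` at one level and the background family's unit datum -/

section Datum

variable (n : ℕ) [NeZero n] (M : Fin d → ℕ) [hM : ∀ μ, NeZero (M μ)]
variable {o : Type*} [Fintype o] [DecidableEq o]
variable {a' : ℝ} {R : Fin d → (Tor (fine n M) → Matrix o o ℂ)} {T : Tor (fine n M) → Matrix o o ℂ} {α τ : ℝ}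

/-- the size of `K_U − K_1`: with `g₁ = (γ_U(0,0))⁻¹`, `gu = (γ_U(α,τ))⁻¹`, `w = dα`, `y = a′τ(2 + 2τ)`,
`hG = √gu·w·g₁ + gu·w·√g₁ + gu·y·g₁`, `hY = τ·gu + hG`: `deltaKB = hY·((1+τ)gu + g₁)`. [folklore] -/
def deltaKB (d : ℕ) (a' α τ : ℝ) : ℝ :=
  (τ * (gammaU d a' α τ)⁻¹
      + (Real.sqrt ((gammaU d a' α τ)⁻¹) * (d * α) * (gammaU d a' 0 0)⁻¹ + (gammaU d a' α τ)⁻¹ * (d * α) * Real.sqrt ((gammaU d a' 0 0)⁻¹)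
        + (gammaU d a' α τ)⁻¹ * (a' * (τ * ((1 + τ) + (1 + τ)))) * (gammaU d a' 0 0)⁻¹))
    * ((1 + τ) * (gammaU d a' α τ)⁻¹ + 1 * (gammaU d a' 0 0)⁻¹)

/-- **`‖K_U − K_1‖ ≤ deltaKB`** at one level (`K = (Q′G′)(Q′G′)ᴴ`). [folklore] -/
theorem opNorm_gramK_sub_gramK_one_le (ha' : 0 < a') (hα : 0 ≤ α) (hτ : 0 ≤ τ)
    (hR : ∀ μ x, ‖connS (fine n M) ((n : ℕ) : ℂ) R μ x‖ ≤ α) (hT : ∀ x, ‖T x - 1‖ ≤ τ) (hγU : 0 < gammaU d a' α τ) :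
    ‖(Bs o n M * siteMul T) * (scalarOp n M a' R T)⁻¹ * (scalarOp n M a' R T)⁻¹ * (Bs o n M * siteMul T)ᴴ
      - (Bs o n M * siteMul (fun _ : Tor (fine n M) => (1 : Matrix o o ℂ))) * (scalarOp n M a' (fun _ _ => (1 : Matrix o o ℂ)) (fun _ => 1))⁻¹
          * (scalarOp n M a' (fun _ _ => (1 : Matrix o o ℂ)) (fun _ => 1))⁻¹ * (Bs o n M * siteMul (fun _ : Tor (fine n M) => (1 : Matrix o o ℂ)))ᴴ‖
      ≤ deltaKB d a' α τ := by
  -- names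
  set Qu := Bs o n M * siteMul T with hQu
  set Q₁ := Bs o n M * siteMul (fun _ : Tor (fine n M) => (1 : Matrix o o ℂ)) with hQ₁
  set Su := scalarOp n M a' R T with hSu
  set S₁ := scalarOp n M a' (fun _ _ => (1 : Matrix o o ℂ)) (fun _ => 1) with hS₁
  have hQ₁B : Q₁ = Bs o n M := by rw [hQ₁, siteMul_one, Matrix.mul_one]
  -- Gram presentations
  have hS₁g : S₁ = (GradOp (fine n M) ((n : ℕ) : ℂ) ⊗ₖ (1 : Matrix o o ℂ))ᴴ * (GradOp (fine n M) ((n : ℕ) : ℂ) ⊗ₖ (1 : Matrix o o ℂ))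
      + (a' : ℂ) • (Q₁ᴴ * Q₁) := by
    rw [hS₁, scalarOp_eq_gram, covGrad_one]
  have hSug : Su = (GradOp (fine n M) ((n : ℕ) : ℂ) ⊗ₖ (1 : Matrix o o ℂ) + defect (fine n M) ((n : ℕ) : ℂ) R)ᴴ
      * (GradOp (fine n M) ((n : ℕ) : ℂ) ⊗ₖ (1 : Matrix o o ℂ) + defect (fine n M) ((n : ℕ) : ℂ) R) + (a' : ℂ) • (Quᴴ * Qu) := by
    rw [hSu, scalarOp_eq_gram, covGrad_eq]
  -- sizes
  have h0free : ∀ μ x, ‖connS (fine n M) ((n : ℕ) : ℂ) (fun (_ : Fin d) (_ : Tor (fine n M)) => (1 : Matrix o o ℂ)) μ x‖ ≤ 0 :=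
    fun μ x => by simp [connS]
  have hT1 : ∀ x : Tor (fine n M), ‖(fun _ : Tor (fine n M) => (1 : Matrix o o ℂ)) x - 1‖ ≤ 0 := fun x => by simp
  have hγ1 : 0 < gammaU d a' 0 0 := by
    have : gammaU d a' α τ ≤ gammaU d a' 0 0 := by
      unfold gammaU; nlinarith [mul_nonneg (Nat.cast_nonneg d) hα, mul_nonneg hτ (by linarith : (0:ℝ) ≤ 2 + τ), ha'.le, sq_nonneg ((d : ℝ) * α)]
    exact lt_of_lt_of_le hγU this
  have hg₁ : ‖S₁⁻¹‖ ≤ (gammaU d a' 0 0)⁻¹ := opNorm_scalarOp_inv_le n M ha' le_rfl le_rfl h0free hT1 hγ1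
  have hgu : ‖Su⁻¹‖ ≤ (gammaU d a' α τ)⁻¹ := opNorm_scalarOp_inv_le n M ha' hα hτ hR hT hγU
  have hW : ‖defect (fine n M) ((n : ℕ) : ℂ) R‖ ≤ d * α :=
    opNorm_defect_le (fine n M) ((n : ℕ) : ℂ) hα fun μ (i : Tor (fine n M) × Fin d) => by
      simpa [connL, connS] using hR μ i.1
  have hQun : ‖Qu‖ ≤ 1 + τ :=
    (Matrix.l2_opNorm_mul _ _).trans ((mul_le_mul (opNorm_Bs_le o n M) (opNorm_siteMul_le_one_add n M hτ hT) (norm_nonneg _)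
      zero_le_one).trans (by rw [one_mul]))
  have hQ₁n : ‖Q₁‖ ≤ 1 + τ := by rw [hQ₁B]; exact (opNorm_Bs_le o n M).trans (by linarith)
  have hQ₁n' : ‖Q₁‖ ≤ 1 := by rw [hQ₁B]; exact opNorm_Bs_le o n M
  have hτQ : ‖Qu - Q₁‖ ≤ τ := by
    rw [hQu, hQ₁B]
    calc ‖Bs o n M * siteMul T - Bs o n M‖ = ‖Bs o n M * (siteMul T - 1)‖ := by rw [Matrix.mul_sub, Matrix.mul_one]
      _ ≤ ‖Bs o n M‖ * ‖siteMul T - 1‖ := Matrix.l2_opNorm_mul _ _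
      _ ≤ 1 * τ := mul_le_mul (opNorm_Bs_le o n M) (opNorm_siteMul_sub_one_le n M hτ hT) (norm_nonneg _) zero_le_one
      _ = τ := one_mul τ
  have hy : ‖(a' : ℂ) • (Quᴴ * Qu) - (a' : ℂ) • (Q₁ᴴ * Q₁)‖ ≤ a' * (τ * ((1 + τ) + (1 + τ))) := by
    rw [← smul_sub, norm_smul, Complex.norm_real, Real.norm_of_nonneg ha'.le]
    refine mul_le_mul_of_nonneg_left ?_ ha'.le
    have h := opNorm_gramK_sub_le Quᴴ Q₁ᴴ
    rw [Matrix.conjTranspose_conjTranspose, Matrix.conjTranspose_conjTranspose, ← Matrix.conjTranspose_sub,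
      Matrix.l2_opNorm_conjTranspose, Matrix.l2_opNorm_conjTranspose, Matrix.l2_opNorm_conjTranspose] at h
    exact h.trans (mul_le_mul hτQ (add_le_add hQun hQ₁n) (by positivity) hτ)
  have hSuU : IsUnit Su.det := (Matrix.isUnit_iff_isUnit_det Su).mp (isUnit_scalarOp n M ha' hα hτ hR hT hγU)
  have hS₁U : IsUnit S₁.det := (Matrix.isUnit_iff_isUnit_det S₁).mp (isUnit_scalarOp n M ha' le_rfl le_rfl h0free hT1 hγ1)
  -- `G_U − G_1`
  have hG := opNorm_inv_sub_inv_le_gram hS₁g hSug (GaugeTermLayer.massTerm_posSemidef a' ha'.le Q₁)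
    (GaugeTermLayer.massTerm_posSemidef a' ha'.le Qu) hS₁U hSuU hg₁ hgu hW hy
  -- `Q_U G_U − Q_1 G_1`
  have hg₁0 : 0 ≤ (gammaU d a' 0 0)⁻¹ := inv_nonneg.mpr hγ1.le
  have hgu0 : 0 ≤ (gammaU d a' α τ)⁻¹ := inv_nonneg.mpr hγU.le
  have hGnn : 0 ≤ Real.sqrt ((gammaU d a' α τ)⁻¹) * (d * α) * (gammaU d a' 0 0)⁻¹
      + (gammaU d a' α τ)⁻¹ * (d * α) * Real.sqrt ((gammaU d a' 0 0)⁻¹)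
      + (gammaU d a' α τ)⁻¹ * (a' * (τ * ((1 + τ) + (1 + τ)))) * (gammaU d a' 0 0)⁻¹ := by positivity
  have hY : ‖Qu * Su⁻¹ - Q₁ * S₁⁻¹‖ ≤ τ * (gammaU d a' α τ)⁻¹
      + (Real.sqrt ((gammaU d a' α τ)⁻¹) * (d * α) * (gammaU d a' 0 0)⁻¹
        + (gammaU d a' α τ)⁻¹ * (d * α) * Real.sqrt ((gammaU d a' 0 0)⁻¹)
        + (gammaU d a' α τ)⁻¹ * (a' * (τ * ((1 + τ) + (1 + τ)))) * (gammaU d a' 0 0)⁻¹) :=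
    (opNorm_mul_sub_mul_le _ _ _ _).trans (add_le_add (mul_le_mul hτQ hgu (norm_nonneg _) hτ)
      ((mul_le_mul hQ₁n' hG (norm_nonneg _) zero_le_one).trans (by rw [one_mul])))
  -- the Gram form `K = (QG′)(QG′)ᴴ`
  have hGuH : (Su⁻¹)ᴴ = Su⁻¹ := by rw [hSu]; exact (scalarOp_inv_isHermitian n M a' R T).eq
  have hG1H : (S₁⁻¹)ᴴ = S₁⁻¹ := by
    rw [hS₁]; exact (scalarOp_inv_isHermitian n M a' (fun _ _ => (1 : Matrix o o ℂ)) (fun _ => 1)).eq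
  have eU : Qu * Su⁻¹ * Su⁻¹ * Quᴴ = (Qu * Su⁻¹) * (Qu * Su⁻¹)ᴴ := by
    rw [Matrix.conjTranspose_mul Qu Su⁻¹, hGuH, Matrix.mul_assoc (Qu * Su⁻¹)]
  have e₁ : Q₁ * S₁⁻¹ * S₁⁻¹ * Q₁ᴴ = (Q₁ * S₁⁻¹) * (Q₁ * S₁⁻¹)ᴴ := by
    rw [Matrix.conjTranspose_mul Q₁ S₁⁻¹, hG1H, Matrix.mul_assoc (Q₁ * S₁⁻¹)]
  rw [eU, e₁]
  have hA : ‖Qu * Su⁻¹‖ ≤ (1 + τ) * (gammaU d a' α τ)⁻¹ :=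
    (Matrix.l2_opNorm_mul _ _).trans (mul_le_mul hQun hgu (norm_nonneg _) (by positivity))
  have hB : ‖Q₁ * S₁⁻¹‖ ≤ 1 * (gammaU d a' 0 0)⁻¹ :=
    (Matrix.l2_opNorm_mul _ _).trans (mul_le_mul hQ₁n' hg₁ (norm_nonneg _) zero_le_one)
  refine (opNorm_gramK_sub_le _ _).trans ((mul_le_mul hY (add_le_add hA hB) (by positivity) (by positivity)).trans (le_of_eq ?_))
  rw [deltaKB]

/-- **THE BACKGROUND FAMILY's UNIT DATUM IS A THEOREM**: `Coercive (σ₀² − deltaKB) (Q′G′G′Q′ᴴ)` from the sizes alone. [folklore] -/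
theorem coercive_gramK_family (ha' : 0 < a') (hα : 0 ≤ α) (hτ : 0 ≤ τ)
    (hR : ∀ μ x, ‖connS (fine n M) ((n : ℕ) : ℂ) R μ x‖ ≤ α) (hT : ∀ x, ‖T x - 1‖ ≤ τ) (hγU : 0 < gammaU d a' α τ) :
    Coercive (sigma0 d a' ^ 2 - deltaKB d a' α τ)
      ((Bs o n M * siteMul T) * (scalarOp n M a' R T)⁻¹ * (scalarOp n M a' R T)⁻¹ * (Bs o n M * siteMul T)ᴴ) :=
  coercive_of_opNorm_sub_le (coercive_gramK_one M ha' n) (opNorm_gramK_sub_gramK_one_le n M ha' hα hτ hR hT hγU)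

end Datum

/-! ## §3 ROOT B's decay stations: `hdec` fed and `hKU` discharged -/

section Final

variable (L : ℕ) [NeZero L] (M : Fin d → ℕ) [hM : ∀ μ, NeZero (M μ)] (a : ℝ) (ha : 0 < a)
variable {o : Type*} [Fintype o] [DecidableEq o]

/-- **ROOT B IN THE DECAY CURRENCY WITH NO ANALYTIC INPUT BEYOND THE END OF RECORD** (`L ≥ 2`, `d ≥ 1`): the owner's
`NE2BalabanDecayRate.balaban_final_decayStations_of_regular` — binders `hreg`, `hNE3` (BY NAME, OPEN), `a′ > 0`, `α, β ≤ η ≤ η⋆`, `‖t‖ ≤ 1` —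
with `hdec` supplied by the chain «Δ3-CT» + «Δ3-CT-HBD» + «Δ3-CT-HBD-B3» + «Δ3-CT-HJ» (substrate VEC-6) + «Δ3-CT-HBD-B4» (E1–E3) and the
background unit datum by §2: what remains is an auxiliary mass `a″ > 0` and NUMERIC smallness — of the rate `κ` (`Jfree`, `deltaK`, `JA`,
`Jcov`, `deltaKU` conditions), of the class size `α` (`γ_U > 0`, `deltaKB`-room in `σ₀²`), and of the coupling (`‖t‖·K < 1`).  Model level;
CONDITIONAL on NE3 + the (3.35)-class + the threshold; the numeric regime is NOT verified for [B9]'s constants nor at `t = 1`; NE2 (U1a) is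
NOT proved by this. [cite: King1986, Lemma 4.5 (4.38) p.674 (shape); Balaban1985BackgroundPropagators, Thm 3.4 p.400 (shape)] [folklore] -/
theorem balaban_final_decayStations_of_regular_numeric (hL : 2 ≤ L) (hd : 1 ≤ d)
    {Rg : (k : ℕ) → Fin d → (Tor (fine (lev L k) M) → Matrix o o ℂ)}
    {α β : ℝ} (hreg : RegularTransporters L M (liftR L M Rg) α β) {C : ℝ} (hC : 0 ≤ C)
    (hNE3 : LocalRate (bgReadings L M (regClass L M (liftR L M Rg))) C ((L : ℝ)⁻¹)) {a' : ℝ} (ha' : 0 < a')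
    {η : ℝ} (hαη : α ≤ η) (hβη : β ≤ η) (hη : η ≤ etaStar o d a a') {t : ℂ} (ht : ‖t‖ ≤ 1)
    {a'' κ : ℝ} (ha'' : 0 < a'') (hκ : 0 ≤ κ) (hγ' : Jfree d a'' κ 1 < gammaPs d a'') (hδ' : deltaK d a'' κ 1 < sigma0 d a'' ^ 2)
    (hJA : JA d a a'' κ 1 < gamD d a)
    (hγU : 0 < gammaU d a' α (Real.exp ((d + 1 : ℕ) * α) - 1))
    (hγ : 0 < gammaU d a' α (Real.exp ((d + 1 : ℕ) * α) - 1) - Jcov (Fintype.card o) d a' α (Real.exp ((d + 1 : ℕ) * α) - 1) κ)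
    (hδU : deltaKU (Fintype.card o) d a' α (Real.exp ((d + 1 : ℕ) * α) - 1) κ
      < sigma0 d a' ^ 2 - deltaKB d a' α (Real.exp ((d + 1 : ℕ) * α) - 1))
    (hγ1 : 0 < gammaU d a' 0 0 - Jcov (Fintype.card o) d a' 0 0 κ) (hδ1 : deltaKU (Fintype.card o) d a' 0 0 κ < sigma0 d a' ^ 2)
    (htK : ‖t‖ * (kappaColCT o d a α β (d * (α ^ 2 + 2 * β)) (max (JA d a a'' κ 1) 0) κ
      + kappaAvgCT (Fintype.card o) d a α (max (JA d a a'' κ 1) 0) κ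
      + kappa4CT (Fintype.card o) d a a' α (sigma0 d a' ^ 2 - deltaKB d a' α (Real.exp ((d + 1 : ℕ) * α) - 1)) (max (JA d a a'' κ 1) 0) κ) < 1) :
    EntryDecay (distKC L M o)
        (pertLimC L M a ha (balabanPert L M a (liftR L M Rg) (gaugeSlot L M Rg (QuT L M o (siteT L M Rg)) (Q1 L M o) a')) t)
        ((gamD d a - max (JA d a a'' κ 1) 0)⁻¹ * (1 - ‖t‖ * (kappaColCT o d a α β (d * (α ^ 2 + 2 * β)) (max (JA d a a'' κ 1) 0) κ
      + kappaAvgCT (Fintype.card o) d a α (max (JA d a a'' κ 1) 0) κ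
      + kappa4CT (Fintype.card o) d a a' α (sigma0 d a' ^ 2 - deltaKB d a' α (Real.exp ((d + 1 : ℕ) * α) - 1)) (max (JA d a a'' κ 1) 0) κ))⁻¹ * Real.exp (κ * 2)) κ ∧
      DecayRate (distKC L M o)
        (pertCovC L M a ha (balabanPert L M a (liftR L M Rg) (gaugeSlot L M Rg (QuT L M o (siteT L M Rg)) (Q1 L M o) a')) t)
        (pertLimC L M a ha (balabanPert L M a (liftR L M Rg) (gaugeSlot L M Rg (QuT L M o (siteT L M Rg)) (Q1 L M o) a')) t)
        (Real.sqrt (2 * ((gamD d a - max (JA d a a'' κ 1) 0)⁻¹ * (1 - ‖t‖ * (kappaColCT o d a α β (d * (α ^ 2 + 2 * β)) (max (JA d a a'' κ 1) 0) κ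
      + kappaAvgCT (Fintype.card o) d a α (max (JA d a a'' κ 1) 0) κ
      + kappa4CT (Fintype.card o) d a a' α (sigma0 d a' ^ 2 - deltaKB d a' α (Real.exp ((d + 1 : ℕ) * α) - 1)) (max (JA d a a'' κ 1) 0) κ))⁻¹ * Real.exp (κ * 2)) *
          (Cpert (kappaBs o d a α β (a * (epsR o d α * (2 + epsR o d α) * Cst d a)) (kappa4F d a a' α β)) (2 * d * Cst d a) (CJ d a)
              (C2Bs o d L a α β C
                (a * C2gram (Cst d a) 1 (epsR o d α) (2 * d * Cst d a) (CJ d a) (Cst d a) (CdeltaR o d a α (theta0 d α (betaNE3 o C))))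
                (C4F o d L a a' α β C)) 0 t / (1 - (L : ℝ)⁻¹))))
        (κ / 2) (Real.sqrt ((L : ℝ)⁻¹)) ∧
      TwoLevelDecayRate (distKC L M o)
        (pertCovC L M a ha (balabanPert L M a (liftR L M Rg) (gaugeSlot L M Rg (QuT L M o (siteT L M Rg)) (Q1 L M o) a')) t)
        (Real.sqrt (2 * ((gamD d a - max (JA d a a'' κ 1) 0)⁻¹ * (1 - ‖t‖ * (kappaColCT o d a α β (d * (α ^ 2 + 2 * β)) (max (JA d a a'' κ 1) 0) κ
      + kappaAvgCT (Fintype.card o) d a α (max (JA d a a'' κ 1) 0) κ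
      + kappa4CT (Fintype.card o) d a a' α (sigma0 d a' ^ 2 - deltaKB d a' α (Real.exp ((d + 1 : ℕ) * α) - 1)) (max (JA d a a'' κ 1) 0) κ))⁻¹ * Real.exp (κ * 2)) * (2 *
          Cpert (kappaBs o d a α β (a * (epsR o d α * (2 + epsR o d α) * Cst d a)) (kappa4F d a a' α β)) (2 * d * Cst d a) (CJ d a)
              (C2Bs o d L a α β C
                (a * C2gram (Cst d a) 1 (epsR o d α) (2 * d * Cst d a) (CJ d a) (Cst d a) (CdeltaR o d a α (theta0 d α (betaNE3 o C))))
                (C4F o d L a a' α β C)) 0 t / (1 - (L : ℝ)⁻¹))))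
        (κ / 2) (Real.sqrt ((L : ℝ)⁻¹)) := by
  have hα : 0 ≤ α := hreg.nonneg.1
  have hτ : 0 ≤ Real.exp ((d + 1 : ℕ) * α) - 1 := sub_nonneg.mpr (Real.one_le_exp (by positivity))
  have hKU : ∀ k, Coercive (sigma0 d a' ^ 2 - deltaKB d a' α (Real.exp ((d + 1 : ℕ) * α) - 1))
      ((QuT L M o (siteT L M Rg) k) * (scalarOp (lev L k) M a' (Rg k) (siteT L M Rg k))⁻¹
        * (scalarOp (lev L k) M a' (Rg k) (siteT L M Rg k))⁻¹ * (QuT L M o (siteT L M Rg) k)ᴴ) := fun k =>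
    coercive_gramK_family (lev L k) M ha' hα hτ (fun μ x => hreg.size k μ (x, μ)) (fun x => norm_siteT_sub_one_le hd hreg k x) hγU
  exact balaban_final_decayStations_of_regular_unitDatum L M a ha hL hd hreg hC hNE3 ha' hαη hβη hη ht ha'' hκ hγ' hδ' hJA hγU hγ hKU hδU
    hγ1 hδ1 htK

end Final

end Summit.QuantumFields.BalabanUV.T4Continuum.CTGaugeUnitDatum

end
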